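/-
Copyright (c) 2026 the pub-hodgecm-mathlib formalisation cell (harness21).  Prover seat hodgecm-mathlib-F0P3a-p02 (g16): road «S3-ram» (LEAD F0P3a-plan (g12); architect
A-p16 (g31) 23:21:51Z deal G6-fin «AXIS BOUNDARY LAW, finite-field half»), organ A′ (ii) (a2) part (B7-iso) G6-fin, FILE 1 (ROOT ∕ MIDDLE axis vertices); 2026-09-01.
-/
import Literature.NumberTheory.Rogawski1990.DepthZeroKappaTransferTypeOneRamifiedRootClassSplit   -- ★ p847208 (this seat): `card_iso_eq_sq` (`#{v : iso} = q²`); ⊇ ★ p847132 F0P3a-p01 (g16) `card_filter_mul_sq_eq` (`#{x : (cx)² = a} = χ a + 1`)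
import HarnessLib

/-!
# The depth-zero κ-transfer at a tame-ramified place, type (1), ISOCELES configuration: the AXIS-VERTEX LAW (finite-field half, G6-fin FILE 1) — a rank-one leading form
# `Q ≡ c·x_u²` on the isotropic conic: `1 + χ(−d₀d₂)` null lines, all other lines of ONE square class; κ-signed over the four twists

Topic `NumberTheory/Rogawski1990`; namespace `Literature.NumberTheory.Rogawski1990`.  THEOREMS ONLY (no definition, no instance, no notation, no named fact, no `sorry`);
kernel lane `--supports stmt-HodgeConjecture-24833`.  Cell `pub/hodgecm-mathlib`, crux H413; road «S3-ram» (Literature seeding, count-neutral), P-1-ram skeleton organ A′ (ii)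
(architect A-p16 (g31)), deal (a2), F0P3a-p01 (g16)'s BLUEPRINT `BLUEPRINT-a2B-TreeInduction.v1` 899adc41 gap **G6 «AXIS BOUNDARY LAW» (B7-iso)**, split 23:21:51Z into the
finite-field half (this seat) and the lattice half (F0P3a-p01 over ★ p847183).  FILE 1 = the ROOT and MIDDLE axis vertices; the END axis vertex (where the two coincident residues
separate) has a different residual datum and is FILE 2.  Siblings: ★ p847132 `…RootTwists` (equilateral null lines), ★ p847196∕p847208 `…RootClassSum ∕ …RootClassSplit` (equilateral
class split).  HONEST LABEL: HC_CM is proved only modulo the 2 remaining named inputs (hLiu418 24832, h413 24833) until rung 0 closes; finite-field algebra only.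

THE MATHEMATICS.  `k` finite, `char k ≠ 2`, `χ = quadraticChar k`; literal `d = (d₀, d₁, d₂) ∈ (k^×)³` (residual form `diag(d)` in the eigen-coordinates `(x_α, x_u, x_γ)`).  In the
ISOCELES configuration `N₁ = N₂ < N` (`|y_α − y_γ| < |y_α − y_u| = |y_γ − y_u|`) the leading term of `t − y_α` at an axis vertex has TWO COINCIDENT residues: `Ȳ ~ diag(0, 2B, 0)` up to
a scalar, and a scalar dies on isotropic vectors, so the root's leading form on the conic is the RANK-ONE form **`Q(v) = c·v_u²`** (`c = 2B·d₁ ≠ 0`, twisting with `d₁`).  Hence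
(vector currency `v ∈ k³ = k × k × k`, each line `q − 1` times):
* NULL vectors `{iso ∧ v_u = 0}` = the isotropic vectors of the binary form `diag(d₀, d₂)`: **`#= 1 + (q−1)·(χ(−d₀d₂) + 1)`** — `1 + χ(−d₀d₂) ∈ {0, 2}` axis LINES (`card_isoAxisNull_eq`);
* CLASS `σ` vectors `{iso ∧ χ(c·v_u²) = σ}`: all non-null lines have the ONE class `χ(c)`: **`#= [χ c = σ]·(q−1)·(q − χ(−d₀d₂))`** — `q − χ(−d₀d₂) ∈ {q−1, q+1}` collar LINES of one sign
  (`card_isoAxisClass_eq`; uses ★ `card_iso_eq_sq`);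
* over the four TWISTS `d^{(b)} = (ε^{b_α}u₀, ε^{b_u}u₁, ε^{b_α+b_u}u₂)`, `χ(ε) = −1`, `κ_b = (−1)^{b_u}`, class constant `c·ε^{b_u}u₁`: `χ(−d₀d₂) = κ_b·χ(−u₀u₂)` and class `= κ_b·χ(cu₁)`, so
  the two literals with `κ_bχ(−u₀u₂) = 1` carry the axis (2 null lines, `q − 1` collar) and the other two are all-collar (`q + 1` lines), and (LINE currency; ×`(q−1)` for vectors)
  **`Σ_b #null_b = 4`, `Σ_b κ_b #null_b = 4χ(−u₀u₂)`, `Σ_b κ_b #{class σ}_b = 2σχ(cu₁)·q − 2χ(−u₀u₂)`, `Σ_b #{class σ}_b = 2q − 2σχ(cu₁)χ(−u₀u₂)`**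
  (`sum_ ∕ signedSum_card_isoAxisNull_twists`, `signedSum_ ∕ sum_card_isoAxisClass_twists`).
KILL-CHECKS (A-p16 (g31) census `cert/axishist.A-p16g31.py`, 23:19:27Z): ROOT q = 3 (3,3,5): 2 axis lines + 2 one-sign collar lines (6 + 6 children) ✓, q = 5: 2 + 4 (10 + 20) ✓;
`b_u`-odd literals: 0 + (q+1) all-collar one sign ✓; MIDDLE axis vertex = the same law in the vertex's own frame (inward + onward = the 2 null lines) ✓.

## References
* [Rogawski1990] J. D. Rogawski, *Automorphic Representations of Unitary Groups in Three Variables*, Ann. of Math. Stud. 123 (1990), §4.9 Prop. 4.9.1 (a)(b) p. 55; §12.2.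
* [LabesseLanglands1979] J.-P. Labesse, R. P. Langlands, *L-indistinguishability for SL(2)*, Canad. J. Math. 31 (1979), §5 (κ-signs over the four classes).
* [IrelandRosen1990] K. Ireland, M. Rosen, *A Classical Introduction to Modern Number Theory*, GTM 84, Ch. 8 §1–§2 (quadratic character counts).
-/

set_option autoImplicit false

namespace Literature.NumberTheory.Rogawski1990

open Finset

variable {k : Type*} [Field k] [Fintype k] [DecidableEq k]

/-! ## §1 One literal: the rank-one (axis) datum `Q = c·x_u²` -/

section OneLiteral

variable {d₀ d₁ d₂ c : k}

/-- **NULL VECTORS OF THE AXIS DATUM: `#{v : Σ dᵢvᵢ² = 0 ∧ v_u = 0} = 1 + (q−1)·(χ(−d₀d₂) + 1)`** — the isotropic vectors of the binary form `diag(d₀, d₂)` on `x_u = 0`; in line currency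
`1 + χ(−d₀d₂) ∈ {0, 2}` AXIS lines (`d₂ ≠ 0`; ★ `card_filter_mul_sq_eq`). [cite: IrelandRosen1990, Ch. 8 §1] [cite: Rogawski1990, §4.9 Prop. 4.9.1 (b) p. 55] -/
theorem card_isoAxisNull_eq (hk : ringChar k ≠ 2) (hd₂ : d₂ ≠ 0) :
    ((univ.filter fun v : k × k × k => d₀ * v.1 ^ 2 + d₁ * v.2.1 ^ 2 + d₂ * v.2.2 ^ 2 = 0 ∧ v.2.1 = 0).card : ℤ) =
      1 + ((Fintype.card k : ℤ) - 1) * (quadraticChar k (-(d₀ * d₂)) + 1) := by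
  rw [natCast_card_filter]
  simp only [Fintype.sum_prod_type]
  -- the `x_u`-sum: only `x_u = 0`
  have hy : ∀ x z : k, (∑ y : k, if d₀ * x ^ 2 + d₁ * y ^ 2 + d₂ * z ^ 2 = 0 ∧ y = 0 then (1 : ℤ) else 0) =
      if (d₂ * z) ^ 2 = -(d₀ * d₂) * x ^ 2 then 1 else 0 := by
    intro x z
    rw [Finset.sum_eq_single (0 : k) (fun y _ hy => by rw [if_neg (fun h => hy h.2)]) (fun h => absurd (Finset.mem_univ _) h)]
    have hiff : d₀ * x ^ 2 + d₁ * (0 : k) ^ 2 + d₂ * z ^ 2 = 0 ↔ (d₂ * z) ^ 2 = -(d₀ * d₂) * x ^ 2 := by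
      constructor
      · intro h
        linear_combination d₂ * h
      · intro h
        have h' : d₂ * (d₀ * x ^ 2 + d₁ * (0 : k) ^ 2 + d₂ * z ^ 2) = 0 := by linear_combination h
        rcases mul_eq_zero.1 h' with h1 | h1
        · exact absurd h1 hd₂
        · exact h1
    by_cases hq : (d₂ * z) ^ 2 = -(d₀ * d₂) * x ^ 2
    · rw [if_pos hq, if_pos ⟨hiff.2 hq, rfl⟩]
    · rw [if_neg hq, if_neg (fun h => hq (hiff.1 h.1))]
  have hz : ∀ x : k, (∑ z : k, if (d₂ * z) ^ 2 = -(d₀ * d₂) * x ^ 2 then (1 : ℤ) else 0) = quadraticChar k (-(d₀ * d₂) * x ^ 2) + 1 := by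
    intro x
    rw [Finset.sum_boole]
    exact card_filter_mul_sq_eq hk hd₂ _
  have hswap : ∀ x : k, (∑ y : k, ∑ z : k, if d₀ * x ^ 2 + d₁ * y ^ 2 + d₂ * z ^ 2 = 0 ∧ y = 0 then (1 : ℤ) else 0) =
      quadraticChar k (-(d₀ * d₂) * x ^ 2) + 1 := by
    intro x
    rw [Finset.sum_comm, ← hz x]
    exact Finset.sum_congr rfl fun z _ => hy x z
  simp_rw [hswap]
  rw [Fintype.sum_eq_add_sum_compl (0 : k)]
  simp only [zero_pow two_ne_zero, mul_zero, MulChar.map_zero, zero_add]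
  have hrest : ∀ x ∈ ({(0 : k)}ᶜ : Finset k), quadraticChar k (-(d₀ * d₂) * x ^ 2) + 1 = quadraticChar k (-(d₀ * d₂)) + 1 := by
    intro x hx
    rw [Finset.mem_compl, Finset.mem_singleton] at hx
    rw [map_mul, map_pow, quadraticChar_sq_one hx, mul_one]
  rw [Finset.sum_congr rfl hrest, Finset.sum_const, Finset.card_compl, Finset.card_singleton, nsmul_eq_mul,
    Nat.cast_sub Fintype.card_pos, Nat.cast_one]

/-- **CLASS VECTORS OF THE AXIS DATUM: `#{v : Σ dᵢvᵢ² = 0 ∧ χ(c·v_u²) = σ} = [χ c = σ]·(q−1)·(q − χ(−d₀d₂))`** for `σ = ±1` — every non-null isotropic line has the ONE class `χ(c)`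
(`χ(c·y²) = χ(c)` for `y ≠ 0`); in line currency `q − χ(−d₀d₂) ∈ {q−1, q+1}` COLLAR lines of one sign (★ `card_iso_eq_sq`: `#{iso} = q²`).
[cite: IrelandRosen1990, Ch. 8 §1] [cite: Rogawski1990, §4.9 Prop. 4.9.1 (b) p. 55] -/
theorem card_isoAxisClass_eq (hk : ringChar k ≠ 2) (hd₀ : d₀ ≠ 0) (hd₁ : d₁ ≠ 0) (hd₂ : d₂ ≠ 0) {σ : ℤ} (hσ : σ = 1 ∨ σ = -1) :
    ((univ.filter fun v : k × k × k => d₀ * v.1 ^ 2 + d₁ * v.2.1 ^ 2 + d₂ * v.2.2 ^ 2 = 0 ∧ quadraticChar k (c * v.2.1 ^ 2) = σ).card : ℤ) =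
      if quadraticChar k c = σ then ((Fintype.card k : ℤ) - 1) * ((Fintype.card k : ℤ) - quadraticChar k (-(d₀ * d₂))) else 0 := by
  have hσ0 : σ ≠ 0 := by rcases hσ with rfl | rfl <;> norm_num
  -- `χ(c y²) = σ ↔ y ≠ 0 ∧ χ c = σ`
  have hclass : ∀ y : k, quadraticChar k (c * y ^ 2) = σ ↔ (¬ y = 0 ∧ quadraticChar k c = σ) := by
    intro y
    by_cases hy : y = 0
    · rw [hy, zero_pow two_ne_zero, mul_zero, MulChar.map_zero]
      simp only [not_true_eq_false, false_and, iff_false]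
      exact fun h => hσ0 h.symm
    · rw [map_mul, map_pow, quadraticChar_sq_one hy, mul_one]
      simp only [hy, not_false_eq_true, true_and]
  by_cases hcσ : quadraticChar k c = σ
  · rw [if_pos hcσ]
    have hfilt : (univ.filter fun v : k × k × k => d₀ * v.1 ^ 2 + d₁ * v.2.1 ^ 2 + d₂ * v.2.2 ^ 2 = 0 ∧ quadraticChar k (c * v.2.1 ^ 2) = σ) =
        univ.filter fun v : k × k × k => d₀ * v.1 ^ 2 + d₁ * v.2.1 ^ 2 + d₂ * v.2.2 ^ 2 = 0 ∧ ¬ v.2.1 = 0 := by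
      refine Finset.filter_congr fun v _ => ?_
      rw [hclass]
      simp only [hcσ, and_true]
    rw [hfilt]
    have hsplit : ((univ.filter fun v : k × k × k => d₀ * v.1 ^ 2 + d₁ * v.2.1 ^ 2 + d₂ * v.2.2 ^ 2 = 0 ∧ ¬ v.2.1 = 0).card : ℤ) =
        ((univ.filter fun v : k × k × k => d₀ * v.1 ^ 2 + d₁ * v.2.1 ^ 2 + d₂ * v.2.2 ^ 2 = 0).card : ℤ) -
        ((univ.filter fun v : k × k × k => d₀ * v.1 ^ 2 + d₁ * v.2.1 ^ 2 + d₂ * v.2.2 ^ 2 = 0 ∧ v.2.1 = 0).card : ℤ) := by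
      rw [natCast_card_filter, natCast_card_filter, natCast_card_filter, ← Finset.sum_sub_distrib]
      refine Finset.sum_congr rfl fun v _ => ?_
      by_cases h : d₀ * v.1 ^ 2 + d₁ * v.2.1 ^ 2 + d₂ * v.2.2 ^ 2 = 0
      · by_cases hy : v.2.1 = 0 <;> simp [h, hy]
      · simp [h]
    rw [hsplit, card_iso_eq_sq hk hd₀ hd₁ hd₂, card_isoAxisNull_eq hk hd₂]
    ring
  · rw [if_neg hcσ]
    have hfilt : (univ.filter fun v : k × k × k => d₀ * v.1 ^ 2 + d₁ * v.2.1 ^ 2 + d₂ * v.2.2 ^ 2 = 0 ∧ quadraticChar k (c * v.2.1 ^ 2) = σ) = ∅ := by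
      refine Finset.filter_eq_empty_iff.2 fun v _ => ?_
      rw [hclass]
      exact fun h => hcσ h.2.2
    rw [hfilt, Finset.card_empty, Nat.cast_zero]

end OneLiteral

/-! ## §2 The four twists: the axis is carried by the two literals with `κ_bχ(−u₀u₂) = 1`; κ-signed and unsigned sums -/

section Twists

variable {u₀ u₁ u₂ ε c : k}

/-- Character values under the twists: `χ(−(ε^iu₀)(ε^{i+j}u₂)) = (−1)^j χ(−u₀u₂)` and `χ(c·ε^ju₁) = (−1)^j χ(cu₁)` (`χ(ε) = −1`). [cite: IrelandRosen1990, Ch. 8 §1] -/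
theorem quadraticChar_axisTwist (hε : quadraticChar k ε = -1) (i j : ℕ) :
    quadraticChar k (-(ε ^ i * u₀ * (ε ^ (i + j) * u₂))) = (-1) ^ j * quadraticChar k (-(u₀ * u₂)) ∧
    quadraticChar k (c * (ε ^ j * u₁)) = (-1) ^ j * quadraticChar k (c * u₁) := by
  have hpow : ∀ n : ℕ, quadraticChar k (ε ^ n) = (-1) ^ n := fun n => by rw [map_pow, hε]
  constructor
  · rw [show -(ε ^ i * u₀ * (ε ^ (i + j) * u₂)) = ε ^ (2 * i + j) * (-(u₀ * u₂)) by ring, map_mul, hpow, pow_add, pow_mul]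
    simp
  · rw [show c * (ε ^ j * u₁) = ε ^ j * (c * u₁) by ring, map_mul, hpow]

/-- **`Σ_b (#null_b − 1) = 4(q−1)`** — four axis-or-not literals carry `4` null LINES in total (the two with `κ_bχ(−u₀u₂) = 1` carry `2` each). [cite: LabesseLanglands1979, §5]
[cite: Rogawski1990, §4.9 Prop. 4.9.1 (b) p. 55] -/
theorem sum_card_isoAxisNull_twists (hk : ringChar k ≠ 2) (hε : quadraticChar k ε = -1) (hu₂ : u₂ ≠ 0) :
    (∑ b : Fin 2 × Fin 2, (((univ.filter fun v : k × k × k =>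
        ε ^ (b.1 : ℕ) * u₀ * v.1 ^ 2 + ε ^ (b.2 : ℕ) * u₁ * v.2.1 ^ 2 + ε ^ ((b.1 : ℕ) + b.2) * u₂ * v.2.2 ^ 2 = 0 ∧ v.2.1 = 0).card : ℤ) - 1)) =
      4 * ((Fintype.card k : ℤ) - 1) := by
  have hε0 : ε ≠ 0 := by
    rintro rfl
    rw [MulChar.map_zero] at hε
    norm_num at hε
  have hb : ∀ b : Fin 2 × Fin 2, ((univ.filter fun v : k × k × k =>
        ε ^ (b.1 : ℕ) * u₀ * v.1 ^ 2 + ε ^ (b.2 : ℕ) * u₁ * v.2.1 ^ 2 + ε ^ ((b.1 : ℕ) + b.2) * u₂ * v.2.2 ^ 2 = 0 ∧ v.2.1 = 0).card : ℤ) - 1 =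
      ((Fintype.card k : ℤ) - 1) * ((-1) ^ (b.2 : ℕ) * quadraticChar k (-(u₀ * u₂)) + 1) := by
    intro b
    rw [card_isoAxisNull_eq hk (mul_ne_zero (pow_ne_zero _ hε0) hu₂), (quadraticChar_axisTwist (u₀ := u₀) (u₁ := u₁) (u₂ := u₂) (c := u₀) hε (b.1 : ℕ) (b.2 : ℕ)).1]
    ring
  simp_rw [hb]
  simp only [Fintype.sum_prod_type, Fin.sum_univ_two, Fin.val_zero, Fin.val_one, pow_zero, pow_one]
  ring

/-- **`Σ_b κ_b·(#null_b − 1) = 4(q−1)·χ(−u₀u₂)`** (`κ_b = (−1)^{b_u}`; in line currency `Σ_b κ_b #null_b = 4χ(−u₀u₂)`). [cite: LabesseLanglands1979, §5]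
[cite: Rogawski1990, §4.9 Prop. 4.9.1 (b) p. 55] -/
theorem signedSum_card_isoAxisNull_twists (hk : ringChar k ≠ 2) (hε : quadraticChar k ε = -1) (hu₂ : u₂ ≠ 0) :
    (∑ b : Fin 2 × Fin 2, (-1 : ℤ) ^ (b.2 : ℕ) * (((univ.filter fun v : k × k × k =>
        ε ^ (b.1 : ℕ) * u₀ * v.1 ^ 2 + ε ^ (b.2 : ℕ) * u₁ * v.2.1 ^ 2 + ε ^ ((b.1 : ℕ) + b.2) * u₂ * v.2.2 ^ 2 = 0 ∧ v.2.1 = 0).card : ℤ) - 1)) =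
      4 * ((Fintype.card k : ℤ) - 1) * quadraticChar k (-(u₀ * u₂)) := by
  have hε0 : ε ≠ 0 := by
    rintro rfl
    rw [MulChar.map_zero] at hε
    norm_num at hε
  have hb : ∀ b : Fin 2 × Fin 2, ((univ.filter fun v : k × k × k =>
        ε ^ (b.1 : ℕ) * u₀ * v.1 ^ 2 + ε ^ (b.2 : ℕ) * u₁ * v.2.1 ^ 2 + ε ^ ((b.1 : ℕ) + b.2) * u₂ * v.2.2 ^ 2 = 0 ∧ v.2.1 = 0).card : ℤ) - 1 =
      ((Fintype.card k : ℤ) - 1) * ((-1) ^ (b.2 : ℕ) * quadraticChar k (-(u₀ * u₂)) + 1) := by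
    intro b
    rw [card_isoAxisNull_eq hk (mul_ne_zero (pow_ne_zero _ hε0) hu₂), (quadraticChar_axisTwist (u₀ := u₀) (u₁ := u₁) (u₂ := u₂) (c := u₀) hε (b.1 : ℕ) (b.2 : ℕ)).1]
    ring
  simp_rw [hb]
  simp only [Fintype.sum_prod_type, Fin.sum_univ_two, Fin.val_zero, Fin.val_one, pow_zero, pow_one]
  ring

/-- **THE κ-SIGNED AXIS CLASS COUNT: `Σ_b κ_b·#{v : iso_b ∧ χ(c·ε^{b_u}u₁·v_u²) = σ} = (q−1)·(2σχ(cu₁)·q − 2χ(−u₀u₂))`** (`σ = ±1`; line currency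
`2σχ(cu₁)q − 2χ(−u₀u₂)`): the class `σ = κ_bχ(cu₁)` is realised by the two literals of one `b_u`-parity, with `q − κ_bχ(−u₀u₂)` collar lines each.
[cite: LabesseLanglands1979, §5] [cite: Rogawski1990, §4.9 Prop. 4.9.1 (b) p. 55; §12.2] -/
theorem signedSum_card_isoAxisClass_twists (hk : ringChar k ≠ 2) (hε : quadraticChar k ε = -1) (hu₀ : u₀ ≠ 0) (hu₁ : u₁ ≠ 0) (hu₂ : u₂ ≠ 0) (hc : c ≠ 0)
    {σ : ℤ} (hσ : σ = 1 ∨ σ = -1) :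
    (∑ b : Fin 2 × Fin 2, (-1 : ℤ) ^ (b.2 : ℕ) * ((univ.filter fun v : k × k × k =>
        ε ^ (b.1 : ℕ) * u₀ * v.1 ^ 2 + ε ^ (b.2 : ℕ) * u₁ * v.2.1 ^ 2 + ε ^ ((b.1 : ℕ) + b.2) * u₂ * v.2.2 ^ 2 = 0 ∧
        quadraticChar k (c * (ε ^ (b.2 : ℕ) * u₁) * v.2.1 ^ 2) = σ).card : ℤ)) =
      ((Fintype.card k : ℤ) - 1) * (2 * σ * quadraticChar k (c * u₁) * (Fintype.card k : ℤ) - 2 * quadraticChar k (-(u₀ * u₂))) := by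
  have hε0 : ε ≠ 0 := by
    rintro rfl
    rw [MulChar.map_zero] at hε
    norm_num at hε
  have hb : ∀ b : Fin 2 × Fin 2, ((univ.filter fun v : k × k × k =>
        ε ^ (b.1 : ℕ) * u₀ * v.1 ^ 2 + ε ^ (b.2 : ℕ) * u₁ * v.2.1 ^ 2 + ε ^ ((b.1 : ℕ) + b.2) * u₂ * v.2.2 ^ 2 = 0 ∧
        quadraticChar k (c * (ε ^ (b.2 : ℕ) * u₁) * v.2.1 ^ 2) = σ).card : ℤ) =
      if (-1) ^ (b.2 : ℕ) * quadraticChar k (c * u₁) = σ then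
        ((Fintype.card k : ℤ) - 1) * ((Fintype.card k : ℤ) - (-1) ^ (b.2 : ℕ) * quadraticChar k (-(u₀ * u₂))) else 0 := by
    intro b
    rw [card_isoAxisClass_eq hk (mul_ne_zero (pow_ne_zero _ hε0) hu₀) (mul_ne_zero (pow_ne_zero _ hε0) hu₁) (mul_ne_zero (pow_ne_zero _ hε0) hu₂) hσ,
      (quadraticChar_axisTwist (u₀ := u₀) (u₁ := u₁) (u₂ := u₂) (c := c) hε (b.1 : ℕ) (b.2 : ℕ)).1,
      (quadraticChar_axisTwist (u₀ := u₀) (u₁ := u₁) (u₂ := u₂) (c := c) hε (b.1 : ℕ) (b.2 : ℕ)).2]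
  simp_rw [hb]
  simp only [Fintype.sum_prod_type, Fin.sum_univ_two, Fin.val_zero, Fin.val_one, pow_zero, pow_one, one_mul, neg_one_mul]
  rcases quadraticChar_dichotomy (mul_ne_zero hc hu₁) with hs | hs <;> rcases hσ with rfl | rfl <;> simp only [hs] <;> norm_num <;> ring

/-- **THE UNSIGNED AXIS CLASS COUNT: `Σ_b #{v : iso_b ∧ χ(c·ε^{b_u}u₁·v_u²) = σ} = (q−1)·(2q − 2σχ(cu₁)χ(−u₀u₂))`** (`σ = ±1`). [cite: LabesseLanglands1979, §5]
[cite: Rogawski1990, §4.9 Prop. 4.9.1 (b) p. 55] -/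
theorem sum_card_isoAxisClass_twists (hk : ringChar k ≠ 2) (hε : quadraticChar k ε = -1) (hu₀ : u₀ ≠ 0) (hu₁ : u₁ ≠ 0) (hu₂ : u₂ ≠ 0) (hc : c ≠ 0)
    {σ : ℤ} (hσ : σ = 1 ∨ σ = -1) :
    (∑ b : Fin 2 × Fin 2, ((univ.filter fun v : k × k × k =>
        ε ^ (b.1 : ℕ) * u₀ * v.1 ^ 2 + ε ^ (b.2 : ℕ) * u₁ * v.2.1 ^ 2 + ε ^ ((b.1 : ℕ) + b.2) * u₂ * v.2.2 ^ 2 = 0 ∧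
        quadraticChar k (c * (ε ^ (b.2 : ℕ) * u₁) * v.2.1 ^ 2) = σ).card : ℤ)) =
      ((Fintype.card k : ℤ) - 1) * (2 * (Fintype.card k : ℤ) - 2 * σ * quadraticChar k (c * u₁) * quadraticChar k (-(u₀ * u₂))) := by
  have hε0 : ε ≠ 0 := by
    rintro rfl
    rw [MulChar.map_zero] at hε
    norm_num at hε
  have hb : ∀ b : Fin 2 × Fin 2, ((univ.filter fun v : k × k × k =>
        ε ^ (b.1 : ℕ) * u₀ * v.1 ^ 2 + ε ^ (b.2 : ℕ) * u₁ * v.2.1 ^ 2 + ε ^ ((b.1 : ℕ) + b.2) * u₂ * v.2.2 ^ 2 = 0 ∧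
        quadraticChar k (c * (ε ^ (b.2 : ℕ) * u₁) * v.2.1 ^ 2) = σ).card : ℤ) =
      if (-1) ^ (b.2 : ℕ) * quadraticChar k (c * u₁) = σ then
        ((Fintype.card k : ℤ) - 1) * ((Fintype.card k : ℤ) - (-1) ^ (b.2 : ℕ) * quadraticChar k (-(u₀ * u₂))) else 0 := by
    intro b
    rw [card_isoAxisClass_eq hk (mul_ne_zero (pow_ne_zero _ hε0) hu₀) (mul_ne_zero (pow_ne_zero _ hε0) hu₁) (mul_ne_zero (pow_ne_zero _ hε0) hu₂) hσ,
      (quadraticChar_axisTwist (u₀ := u₀) (u₁ := u₁) (u₂ := u₂) (c := c) hε (b.1 : ℕ) (b.2 : ℕ)).1,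
      (quadraticChar_axisTwist (u₀ := u₀) (u₁ := u₁) (u₂ := u₂) (c := c) hε (b.1 : ℕ) (b.2 : ℕ)).2]
  simp_rw [hb]
  simp only [Fintype.sum_prod_type, Fin.sum_univ_two, Fin.val_zero, Fin.val_one, pow_zero, pow_one, one_mul, neg_one_mul]
  have hχ0 : quadraticChar k (-(u₀ * u₂)) = 1 ∨ quadraticChar k (-(u₀ * u₂)) = -1 := quadraticChar_dichotomy (neg_ne_zero.2 (mul_ne_zero hu₀ hu₂))
  rcases quadraticChar_dichotomy (mul_ne_zero hc hu₁) with hs | hs <;> rcases hσ with rfl | rfl <;> simp only [hs] <;> norm_num <;> ring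

end Twists

end Literature.NumberTheory.Rogawski1990
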